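import Literature.AlgebraicGeometry.Modules.ModuleCechStrataBaseChange
import Literature.Algebra.Homology.OrderedCechSystemBaseChange
import HarnessLib

/-!
# Affine test objects over an affine base: base change of the module Čech complex along `1 × j` (GW II 22.90, 23.135)

`T` affine with ring `A`, `𝓥` a finite family of affine opens of `X = P ×_K T` with affine intersections, `L`
finite locally free. An **affine test object** is `j : T' → T`, `T'` affine (`B' = Γ(T', 𝒪)` an `A`-algebra via
`j♯`, `testAlgebra`); `g = 1 × j` (`testMap`), `g⁻¹𝓥` (`testCover`), `g^*L` (`testMod`). §0 `kerEquivOfSquare`;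
§1 `testTensorEquiv : B' ⊗_A Γ(L, V_s) ≃ₗ[B'] Γ(g^*L, g⁻¹V_s)` (★ `Modules/PullbackSectionsBaseChange`, natural in
`s`); §2 `cochainBC`, `kerDZeroBaseChangeEquiv : ker(1 ⊗ d⁰ on B' ⊗_A Č⁰(𝓥, L)) ≃ ker(d⁰ of g^*L)`
(`Algebra/Homology/OrderedCechSystemBaseChange`); §4 (data of the naturality square for `k : T'' → T'` over `T`)
`testModCompIso : (1 × k)^* g'^*L ≅ g''^*L`, `pullSecLE`/`pullSec` (pull-back of sections), `testAlgHom = k♯`.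
The termwise computation of Görtz–Wedhorn II, proof of Prop. 22.90, organised for the kernel representation of
`Modules/GrothendieckComplexKernelRepr` (Cor. 23.135; Mumford §5, Lemma 2, Cor. 2). Everything is proved; no
named facts. Mathlib searched (pin): `LinearEquiv.ofBijective`, `TensorProduct.AlgebraTensorModule.map` (used).
Cell `hodgecm-mathlib`, M13 node N1 (1b) (B-p10 (g8), cut/couriered by B-p15 (g8), B-plan1 R140/R142); generic.

## References

* U. Görtz, T. Wedhorn, *Algebraic Geometry II* (2023), doi:10.1007/978-3-658-43031-3: Prop. 22.90 (p. 277),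
  proof; Cor. 23.135 (p. 355); (23.28.5). [GortzWedhorn2023]
* U. Görtz, T. Wedhorn, *Algebraic Geometry I*, 2nd ed. (2020), Prop. 7.24 (2), Rem. 7.25. [GortzWedhorn2020]
* D. Mumford, *Abelian Varieties* (1970), §5, Lemmas 1–2, Cor. 2 (pp. 46–50). [MumfordAV1970]
-/

universe u

open CategoryTheory CategoryTheory.Limits AlgebraicGeometry TopologicalSpace Opposite MonoidalCategory
open CartesianMonoidalCategory TensorProduct
open Literature.AlgebraicGeometry.Motives Literature.Algebra.Homology

set_option backward.isDefEq.respectTransparency false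

noncomputable section
namespace Literature.AlgebraicGeometry.Modules

/-! ### §0 Kernels along a commutative square with isomorphic sources -/
section KerTransport

variable {R : Type u} [CommRing R] {M₀ M₁ N₀ N₁ : Type u} [AddCommGroup M₀] [Module R M₀] [AddCommGroup M₁]
  [Module R M₁] [AddCommGroup N₀] [Module R N₀] [AddCommGroup N₁] [Module R N₁]

/-- **`ker d ≃ ker d'` along a square `e₁ ∘ d = d' ∘ e₀` with `e₀` bijective and `e₁` injective.** [folklore] [cite: GortzWedhorn2023, Prop. 22.90 (p. 277), proof] -/
def kerEquivOfSquare (d : M₀ →ₗ[R] M₁) (d' : N₀ →ₗ[R] N₁) (e₀ : M₀ ≃ₗ[R] N₀) (e₁ : M₁ →ₗ[R] N₁)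
    (he₁ : Function.Injective e₁) (h : ∀ x, e₁ (d x) = d' (e₀ x)) :
    LinearMap.ker d ≃ₗ[R] LinearMap.ker d' where
  toFun x := ⟨e₀ x.1, by
    rw [LinearMap.mem_ker, ← h, (LinearMap.mem_ker.1 x.2), map_zero]⟩
  invFun y := ⟨e₀.symm y.1, by
    rw [LinearMap.mem_ker]
    apply he₁
    rw [h, LinearEquiv.apply_symm_apply, (LinearMap.mem_ker.1 y.2), map_zero]⟩
  map_add' x y := by apply Subtype.ext; exact map_add e₀ x.1 y.1
  map_smul' c x := by apply Subtype.ext; exact LinearEquiv.map_smul e₀ c x.1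
  left_inv x := by apply Subtype.ext; exact e₀.symm_apply_apply x.1
  right_inv y := by apply Subtype.ext; exact e₀.apply_symm_apply y.1

/-- The transport on underlying elements. [folklore] [cite: GortzWedhorn2023, Prop. 22.90 (p. 277), proof] -/
@[simp] theorem coe_kerEquivOfSquare_apply (d : M₀ →ₗ[R] M₁) (d' : N₀ →ₗ[R] N₁) (e₀ : M₀ ≃ₗ[R] N₀)
    (e₁ : M₁ →ₗ[R] N₁) (he₁ : Function.Injective e₁) (h : ∀ x, e₁ (d x) = d' (e₀ x))
    (x : LinearMap.ker d) : (kerEquivOfSquare d d' e₀ e₁ he₁ h x : N₀) = e₀ x := rfl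

end KerTransport

/-! ### §1 Affine test objects over an affine base and the base change of the module Čech complex -/
section Test

variable {K : Type u} [Field K] (P T : SchemeOver K) [IsAffine T.left] {T' : SchemeOver K} [IsAffine T'.left]
  (j : T' ⟶ T)
variable {ι : Type} (𝓥 : ι → (P ⊗ T).left.Opens) (L : (P ⊗ T).left.Modules)

/-- The base-changed total space map `g = 1 × j : P ×_K T' → P ×_K T`. [folklore] [cite: GortzWedhorn2023, Prop. 22.90 (p. 277), proof] -/
abbrev testMap : (P ⊗ T').left ⟶ (P ⊗ T).left := (P ◁ j).left

/-- The pulled-back cover `g⁻¹𝓥`. [folklore] [cite: GortzWedhorn2023, Prop. 22.90 (p. 277), proof] -/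
abbrev testCover : ι → (P ⊗ T').left.Opens := fun i => testMap P T j ⁻¹ᵁ 𝓥 i

/-- The pulled-back module `g^*L`. [folklore] [cite: GortzWedhorn2023, Prop. 22.90 (p. 277), proof] -/
abbrev testMod : (P ⊗ T').left.Modules := (Scheme.Modules.pullback (testMap P T j)).obj L

/-- `j♯ : A = Γ(T, 𝒪) → B' = Γ(T', 𝒪)` in `appLE ⊤ ⊤` form. [folklore] [cite: GortzWedhorn2023, Prop. 22.90 (p. 277), proof] -/
abbrev testRingHom : Γ(T.left, ⊤) →+* Γ(T'.left, ⊤) := (j.left.appLE ⊤ ⊤ le_top).hom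

/-- The `A`-algebra structure on `B' = Γ(T', 𝒪)` through `j♯` (reducible; used with `letI`). [folklore] [cite: GortzWedhorn2023, Prop. 22.90 (p. 277), proof] -/
@[reducible] def testAlgebra : Algebra Γ(T.left, ⊤) Γ(T'.left, ⊤) := (testRingHom T j).toAlgebra

omit [IsAffine T.left] [IsAffine T'.left] in
/-- `(g⁻¹𝓥)_s = g⁻¹(V_s) ∩ pr⁻¹⊤`. [folklore] [cite: GortzWedhorn2023, Prop. 22.90 (p. 277), proof] -/
theorem cechOpen_testCover_eq (s : Finset ι) :
    cechOpen (testCover P T j 𝓥) s = testMap P T j ⁻¹ᵁ cechOpen 𝓥 s ⊓ (snd P T').left ⁻¹ᵁ ⊤ := by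
  rw [← preimage_cechOpen, Scheme.Hom.preimage_top, inf_top_eq]

variable (hV : ∀ s : Finset ι, s.Nonempty → IsAffineOpen (cechOpen 𝓥 s)) (hL : IsFiniteLocallyFree L)

include hV hL in
/-- **`B' ⊗_A Γ(L, V_s) ≃ₗ[B'] Γ(g^*L, g⁻¹V_s)`, `b ⊗ m ↦ b · η(m)|`** for an affine test object `j : T' → T`
(★ `exists_linearEquiv_tensor_sections_pullback` on the cartesian square ★ `isPullback_whiskerLeft_snd P j`).
[cite: GortzWedhorn2020, Prop. 7.24 (2) and Rem. 7.25] -/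
theorem exists_test_tensor_equiv (s : Finset ι) (hs : s.Nonempty) :
    letI := testAlgebra T j
    ∃ e : Γ(T'.left, ⊤) ⊗[Γ(T.left, ⊤)] SecMod L (baseToTotal P T) (cechOpen 𝓥 s) ≃ₗ[Γ(T'.left, ⊤)]
        SecMod (testMod P T j L) (baseToTotal P T') (cechOpen (testCover P T j 𝓥) s),
      ∀ (b : Γ(T'.left, ⊤)) (m : SecMod L (baseToTotal P T) (cechOpen 𝓥 s)),
        e (b ⊗ₜ m) = b • SecMod.mk (ρ := baseToTotal P T') (unitSectionLE (testMap P T j) L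
          (le_preimage_left_of_eq_inf (cechOpen_testCover_eq P T j 𝓥 s)) (SecMod.val m)) := by
  letI := testAlgebra T j
  letI : Module Γ(T.left, ⊤) Γ(L, cechOpen 𝓥 s) := SecMod.instModule L (baseToTotal P T) (cechOpen 𝓥 s)
  letI : Module Γ(T'.left, ⊤) Γ(testMod P T j L, cechOpen (testCover P T j 𝓥) s) :=
    SecMod.instModule (testMod P T j L) (baseToTotal P T') (cechOpen (testCover P T j 𝓥) s)
  haveI := hL.isVectorBundle.1
  exact exists_linearEquiv_tensor_sections_pullback (isPullback_whiskerLeft_snd P j)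
    (isAffineOpen_top T.left) (isAffineOpen_top T'.left) (hV s hs) le_top
    (fun x _ => trivial) (cechOpen_testCover_eq P T j 𝓥 s) L (IsAffineLocalizing.of_isQuasicoherent L)
    rfl (fun r m => rfl) (fun t n => rfl)

/-- A choice of the `B'`-linear base-change isomorphism on a non-empty member. [folklore] [cite: GortzWedhorn2023, Prop. 22.90 (p. 277), proof] -/
def testTensorEquiv (s : Finset ι) (hs : s.Nonempty) :
    letI := testAlgebra T j
    Γ(T'.left, ⊤) ⊗[Γ(T.left, ⊤)] SecMod L (baseToTotal P T) (cechOpen 𝓥 s) ≃ₗ[Γ(T'.left, ⊤)]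
      SecMod (testMod P T j L) (baseToTotal P T') (cechOpen (testCover P T j 𝓥) s) :=
  letI := testAlgebra T j
  Classical.choose (exists_test_tensor_equiv P T j 𝓥 L hV hL s hs)

/-- `testTensorEquiv (b ⊗ m) = b · η(m)|`. [folklore] [cite: GortzWedhorn2023, Prop. 22.90 (p. 277), proof] -/
theorem testTensorEquiv_tmul (s : Finset ι) (hs : s.Nonempty) (b : Γ(T'.left, ⊤))
    (m : SecMod L (baseToTotal P T) (cechOpen 𝓥 s)) :
    letI := testAlgebra T j
    testTensorEquiv P T j 𝓥 L hV hL s hs (b ⊗ₜ m) =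
      b • SecMod.mk (ρ := baseToTotal P T') (unitSectionLE (testMap P T j) L
        (le_preimage_left_of_eq_inf (cechOpen_testCover_eq P T j 𝓥 s)) (SecMod.val m)) :=
  Classical.choose_spec (exists_test_tensor_equiv P T j 𝓥 L hV hL s hs) b m

/-- **The pull-back of sections `Θ_s : Γ(L, V_s) → Γ(g^*L, g⁻¹V_s)`, `m ↦ η(m)|` as a `j♯`-SEMILINEAR map**
(read off the `B'`-linear base change at `1 ⊗ m`). [folklore] [cite: GortzWedhorn2023, Prop. 22.90 (p. 277), proof] -/
def testTheta (s : Finset ι) (hs : s.Nonempty) :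
    SecMod L (baseToTotal P T) (cechOpen 𝓥 s) →ₛₗ[testRingHom T j]
      SecMod (testMod P T j L) (baseToTotal P T') (cechOpen (testCover P T j 𝓥) s) :=
  letI := testAlgebra T j
  { toFun := fun m => testTensorEquiv P T j 𝓥 L hV hL s hs (1 ⊗ₜ m)
    map_add' := fun m m' => by rw [TensorProduct.tmul_add, map_add]
    map_smul' := fun a m => by
      rw [← TensorProduct.smul_tmul, ← LinearEquiv.map_smul]
      congr 1 }

/-- `Θ_s m = e_s (1 ⊗ m)`. [folklore] [cite: GortzWedhorn2023, Prop. 22.90 (p. 277), proof] -/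
theorem testTheta_apply (s : Finset ι) (hs : s.Nonempty) (m : SecMod L (baseToTotal P T) (cechOpen 𝓥 s)) :
    letI := testAlgebra T j
    testTheta P T j 𝓥 L hV hL s hs m = testTensorEquiv P T j 𝓥 L hV hL s hs (1 ⊗ₜ m) := rfl

/-- The base-change map of F1 built from `Θ` IS the chosen isomorphism `e_s`. [folklore] [cite: GortzWedhorn2023, Prop. 22.90 (p. 277), proof] -/
theorem sysBaseChangeMap_testTheta_eq (s : Finset ι) (hs : s.Nonempty)
    (z : letI := testAlgebra T j; Γ(T'.left, ⊤) ⊗[Γ(T.left, ⊤)] SecMod L (baseToTotal P T) (cechOpen 𝓥 s)) :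
    letI := testAlgebra T j
    OrderedCech.sysBaseChangeMap (testRingHom T j) (M := sectionsSystem 𝓥 L (baseToTotal P T))
        (M' := sectionsSystem (testCover P T j 𝓥) (testMod P T j L) (baseToTotal P T'))
        (fun t => if ht : t.Nonempty then testTheta P T j 𝓥 L hV hL t ht else 0) s z =
      testTensorEquiv P T j 𝓥 L hV hL s hs z := by
  letI := testAlgebra T j
  induction z using TensorProduct.induction_on with
  | zero => rw [map_zero, map_zero]
  | tmul b m =>
    rw [OrderedCech.sysBaseChangeMap_tmul, dif_pos hs]
    change b • testTensorEquiv P T j 𝓥 L hV hL s hs (1 ⊗ₜ m) = _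
    rw [← LinearEquiv.map_smul, TensorProduct.smul_tmul', smul_eq_mul, mul_one]
  | add x y hx hy => rw [map_add, map_add, hx, hy]

end Test

/-! ### §2 The base change of `d⁰` on an affine test object -/
section KernelBC

variable {K : Type u} [Field K] (P T : SchemeOver K) [IsAffine T.left] {T' : SchemeOver K} [IsAffine T'.left]
  (j : T' ⟶ T)
variable {ι : Type} [LinearOrder ι] (𝓥 : ι → (P ⊗ T).left.Opens) (L : (P ⊗ T).left.Modules)
variable (hV : ∀ s : Finset ι, s.Nonempty → IsAffineOpen (cechOpen 𝓥 s)) (hL : IsFiniteLocallyFree L)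

/-- The `Θ`-family on all members (zero on `∅`, which never enters). [folklore] [cite: GortzWedhorn2023, Prop. 22.90 (p. 277), proof] -/
def testThetaFamily (s : Finset ι) :
    SecMod L (baseToTotal P T) (cechOpen 𝓥 s) →ₛₗ[testRingHom T j]
      SecMod (testMod P T j L) (baseToTotal P T') (cechOpen (testCover P T j 𝓥) s) :=
  if hs : s.Nonempty then testTheta P T j 𝓥 L hV hL s hs else 0

omit [LinearOrder ι] in
/-- `Θ` is compatible with restriction (naturality of the affine base change in the open). [folklore] [cite: GortzWedhorn2023, Prop. 22.90 (p. 277), proof] -/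
theorem testThetaFamily_natural {s t : Finset ι} (hs : s.Nonempty) (h : s ⟶ t)
    (x : SecMod L (baseToTotal P T) (cechOpen 𝓥 s)) :
    testThetaFamily P T j 𝓥 L hV hL t (((sectionsSystem 𝓥 L (baseToTotal P T)).map h).hom x) =
      ((sectionsSystem (testCover P T j 𝓥) (testMod P T j L) (baseToTotal P T')).map h).hom
        (testThetaFamily P T j 𝓥 L hV hL s x) := by
  letI := testAlgebra T j
  have ht : t.Nonempty := hs.mono h.le
  rw [testThetaFamily, dif_pos ht, testThetaFamily, dif_pos hs, testTheta_apply, testTheta_apply]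
  letI : Module Γ(T.left, ⊤) Γ(L, cechOpen 𝓥 s) := SecMod.instModule L (baseToTotal P T) (cechOpen 𝓥 s)
  letI : Module Γ(T.left, ⊤) Γ(L, cechOpen 𝓥 t) := SecMod.instModule L (baseToTotal P T) (cechOpen 𝓥 t)
  letI : Module Γ(T'.left, ⊤) Γ(testMod P T j L, cechOpen (testCover P T j 𝓥) s) :=
    SecMod.instModule (testMod P T j L) (baseToTotal P T') (cechOpen (testCover P T j 𝓥) s)
  letI : Module Γ(T'.left, ⊤) Γ(testMod P T j L, cechOpen (testCover P T j 𝓥) t) :=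
    SecMod.instModule (testMod P T j L) (baseToTotal P T') (cechOpen (testCover P T j 𝓥) t)
  have key := map_tensor_sections_pullback_natural (iY := (snd P T').left)
    (cechOpen_testCover_eq P T j 𝓥 s) (cechOpen_testCover_eq P T j 𝓥 t) (cechOpen_anti 𝓥 h.le)
    L (fun _ _ => rfl) (fun _ _ => rfl)
    (SecMod.res L (baseToTotal P T) (cechOpen_anti 𝓥 h.le)) (fun _ => rfl)
    (testTensorEquiv P T j 𝓥 L hV hL s hs).toLinearMap (testTensorEquiv_tmul P T j 𝓥 L hV hL s hs)
    (testTensorEquiv P T j 𝓥 L hV hL t ht).toLinearMap (testTensorEquiv_tmul P T j 𝓥 L hV hL t ht)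
    ((1 : Γ(T'.left, ⊤)) ⊗ₜ x)
  rw [TensorProduct.map_tmul, LinearMap.id_apply] at key
  exact key.symm

omit [LinearOrder ι] in
/-- The termwise base-change maps built from `Θ` are bijective (they ARE the chosen isomorphisms). [folklore] [cite: GortzWedhorn2023, Prop. 22.90 (p. 277), proof] -/
theorem testThetaFamily_bijective (s : Finset ι) (hs : s.Nonempty) :
    letI := testAlgebra T j
    Function.Bijective (OrderedCech.sysBaseChangeMap (testRingHom T j) (M := sectionsSystem 𝓥 L (baseToTotal P T))
      (M' := sectionsSystem (testCover P T j 𝓥) (testMod P T j L) (baseToTotal P T'))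
      (testThetaFamily P T j 𝓥 L hV hL) s) := by
  letI := testAlgebra T j
  have heq : (OrderedCech.sysBaseChangeMap (testRingHom T j) (M := sectionsSystem 𝓥 L (baseToTotal P T))
      (M' := sectionsSystem (testCover P T j 𝓥) (testMod P T j L) (baseToTotal P T'))
      (testThetaFamily P T j 𝓥 L hV hL) s : _ → _) = testTensorEquiv P T j 𝓥 L hV hL s hs := by
    funext z
    exact sysBaseChangeMap_testTheta_eq P T j 𝓥 L hV hL s hs z
  rw [heq]
  exact (testTensorEquiv P T j 𝓥 L hV hL s hs).bijective

/-- The cochain-level base change in degree `n`, as a `B'`-linear map (F1 `sysCochainBaseChange` for `Θ`). [folklore] [cite: GortzWedhorn2023, Prop. 22.90 (p. 277), proof] -/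
abbrev cochainBC (n : ℤ) :
    letI := testAlgebra T j
    Γ(T'.left, ⊤) ⊗[Γ(T.left, ⊤)] OrderedCech.SysCochain (sectionsSystem 𝓥 L (baseToTotal P T)) n →ₗ[Γ(T'.left, ⊤)]
      OrderedCech.SysCochain (sectionsSystem (testCover P T j 𝓥) (testMod P T j L) (baseToTotal P T')) n :=
  letI := testAlgebra T j
  OrderedCech.sysCochainBaseChange (testRingHom T j) (testThetaFamily P T j 𝓥 L hV hL) n

/-- `(Θ ⊗ 1)(b ⊗ g) = b • Θ(g)`. [folklore] [cite: GortzWedhorn2023, Prop. 22.90 (p. 277), proof] -/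
theorem cochainBC_tmul (n : ℤ) (b : Γ(T'.left, ⊤)) (g : OrderedCech.SysCochain (sectionsSystem 𝓥 L (baseToTotal P T)) n) :
    letI := testAlgebra T j
    cochainBC P T j 𝓥 L hV hL n (b ⊗ₜ g) =
      b • OrderedCech.SysCochain.mapₛₗ (testRingHom T j) (testThetaFamily P T j 𝓥 L hV hL) n g :=
  OrderedCech.sysCochainBaseChange_tmul _ _ n b g

/-- Pointwise scalar multiplication of system cochains. [folklore] [cite: GortzWedhorn2023, Prop. 22.90 (p. 277), proof] -/
theorem _root_.Literature.AlgebraicGeometry.Modules.OrderedCech.SysCochain.smul_apply' {A : Type u} [CommRing A]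
    {κ : Type} [LinearOrder κ] (M : Finset κ ⥤ ModuleCat.{u} A) {n : ℤ} (c : A) (g : OrderedCech.SysCochain M n)
    (σ : OrderedCech.Simplex κ n) : (c • g) σ = c • g σ := rfl

/-- Pointwise addition of system cochains. [folklore] [cite: GortzWedhorn2023, Prop. 22.90 (p. 277), proof] -/
theorem _root_.Literature.AlgebraicGeometry.Modules.OrderedCech.SysCochain.add_apply' {A : Type u} [CommRing A]
    {κ : Type} [LinearOrder κ] (M : Finset κ ⥤ ModuleCat.{u} A) {n : ℤ} (g g' : OrderedCech.SysCochain M n)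
    (σ : OrderedCech.Simplex κ n) : (g + g') σ = g σ + g' σ := rfl

/-- The zero system cochain is pointwise zero. [folklore] [cite: GortzWedhorn2023, Prop. 22.90 (p. 277), proof] -/
theorem _root_.Literature.AlgebraicGeometry.Modules.OrderedCech.SysCochain.zero_apply' {A : Type u} [CommRing A]
    {κ : Type} [LinearOrder κ] (M : Finset κ ⥤ ModuleCat.{u} A) {n : ℤ} (σ : OrderedCech.Simplex κ n) :
    (0 : OrderedCech.SysCochain M n) σ = 0 := rfl

/-- **The cochain base change intertwines `d⁰ ⊗ B'` and `d⁰`.** [folklore] [cite: GortzWedhorn2023, Prop. 22.90 (p. 277), proof] -/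
theorem cochainBC_baseChange_sysD
    (z : letI := testAlgebra T j; Γ(T'.left, ⊤) ⊗[Γ(T.left, ⊤)] OrderedCech.SysCochain (sectionsSystem 𝓥 L (baseToTotal P T)) 0) :
    letI := testAlgebra T j
    cochainBC P T j 𝓥 L hV hL 1 (((OrderedCech.sysD (sectionsSystem 𝓥 L (baseToTotal P T)) 0).baseChange Γ(T'.left, ⊤)) z) =
      OrderedCech.sysD (sectionsSystem (testCover P T j 𝓥) (testMod P T j L) (baseToTotal P T')) 0
        (cochainBC P T j 𝓥 L hV hL 0 z) := by
  letI := testAlgebra T j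
  induction z using TensorProduct.induction_on with
  | zero => simp only [map_zero]
  | tmul b g =>
    rw [LinearMap.baseChange_tmul]
    change OrderedCech.sysCochainBaseChange _ _ 1 _ = OrderedCech.sysD _ 0 (OrderedCech.sysCochainBaseChange _ _ 0 _)
    rw [OrderedCech.sysCochainBaseChange_tmul, OrderedCech.sysCochainBaseChange_tmul, map_smul]
    congr 1
    exact (OrderedCech.sysD_mapₛₗ (testRingHom T j) (M := sectionsSystem 𝓥 L (baseToTotal P T))
      (M' := sectionsSystem (testCover P T j 𝓥) (testMod P T j L) (baseToTotal P T'))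
      (testThetaFamily P T j 𝓥 L hV hL)
      (fun {s} {t} hs h x => testThetaFamily_natural P T j 𝓥 L hV hL hs h x) g).symm
  | add x y hx hy => simp only [map_add, hx, hy]

/-- **Degrees `0 → 1` of the base change `B' ⊗_A Č•(𝓥, L) ≅ Č•(g⁻¹𝓥, g^*L)` give an isomorphism of the kernels
of the first differentials.** [cite: GortzWedhorn2023, Prop. 22.90 (p. 277), proof] -/
def kerDZeroBaseChangeEquiv [Fintype ι] :
    letI := testAlgebra T j
    LinearMap.ker ((OrderedCech.sysD (sectionsSystem 𝓥 L (baseToTotal P T)) 0).baseChange Γ(T'.left, ⊤)) ≃ₗ[Γ(T'.left, ⊤)]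
      LinearMap.ker (OrderedCech.sysD (sectionsSystem (testCover P T j 𝓥) (testMod P T j L) (baseToTotal P T')) 0) :=
  letI := testAlgebra T j
  kerEquivOfSquare
    ((OrderedCech.sysD (sectionsSystem 𝓥 L (baseToTotal P T)) 0).baseChange Γ(T'.left, ⊤))
    (OrderedCech.sysD (sectionsSystem (testCover P T j 𝓥) (testMod P T j L) (baseToTotal P T')) 0)
    (LinearEquiv.ofBijective (cochainBC P T j 𝓥 L hV hL 0)
      (OrderedCech.sysCochainBaseChange_bijective _ _ (testThetaFamily_bijective P T j 𝓥 L hV hL) 0))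
    (cochainBC P T j 𝓥 L hV hL 1)
    (OrderedCech.sysCochainBaseChange_bijective _ _ (testThetaFamily_bijective P T j 𝓥 L hV hL) 1).1
    (fun z => cochainBC_baseChange_sysD P T j 𝓥 L hV hL z)

/-- Underlying cochain of `kerDZeroBaseChangeEquiv z`: the degree-`0` cochain base change of `z`. [folklore] [cite: GortzWedhorn2023, Prop. 22.90 (p. 277), proof] -/
theorem coe_kerDZeroBaseChangeEquiv_apply [Fintype ι]
    (z : letI := testAlgebra T j
      LinearMap.ker ((OrderedCech.sysD (sectionsSystem 𝓥 L (baseToTotal P T)) 0).baseChange Γ(T'.left, ⊤))) :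
    letI := testAlgebra T j
    ((kerDZeroBaseChangeEquiv P T j 𝓥 L hV hL z :
        LinearMap.ker (OrderedCech.sysD (sectionsSystem (testCover P T j 𝓥) (testMod P T j L) (baseToTotal P T')) 0)) :
      OrderedCech.SysCochain (sectionsSystem (testCover P T j 𝓥) (testMod P T j L) (baseToTotal P T')) 0) =
      cochainBC P T j 𝓥 L hV hL 0 (z : _) := rfl

/-- `cochainBC 0` undoes `kerDZeroBaseChangeEquiv.symm` on underlying cochains. [folklore] [cite: GortzWedhorn2023, Prop. 22.90 (p. 277), proof] -/
theorem cochainBC_kerDZeroBaseChangeEquiv_symm [Fintype ι]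
    (y : LinearMap.ker (OrderedCech.sysD (sectionsSystem (testCover P T j 𝓥) (testMod P T j L) (baseToTotal P T')) 0)) :
    letI := testAlgebra T j
    cochainBC P T j 𝓥 L hV hL 0 (((kerDZeroBaseChangeEquiv P T j 𝓥 L hV hL).symm y : LinearMap.ker _) : _) =
      (y : _) := by
  letI := testAlgebra T j
  rw [← coe_kerDZeroBaseChangeEquiv_apply, LinearEquiv.apply_symm_apply]

end KernelBC

/-! ### §4 Naturality of the kernel representation in the test object -/
section Naturality

variable {K : Type u} [Field K] (P T : SchemeOver K) [IsAffine T.left]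
variable {ι : Type} [LinearOrder ι] [Fintype ι] (𝓥 : ι → (P ⊗ T).left.Opens) (L : (P ⊗ T).left.Modules)
variable (hV : ∀ s : Finset ι, s.Nonempty → IsAffineOpen (cechOpen 𝓥 s)) (hcov : ⨆ i, 𝓥 i = ⊤)
variable {T' T'' : SchemeOver K} [IsAffine T'.left] [IsAffine T''.left] (j' : T' ⟶ T) (j'' : T'' ⟶ T)
  (k : T'' ⟶ T') (hk : k ≫ j' = j'')

include hk in
omit [IsAffine T.left] [IsAffine T'.left] [IsAffine T''.left] in
/-- `1 × k ≫ 1 × j' = 1 × j''` on total spaces. [folklore] [cite: GortzWedhorn2023, Prop. 22.90 (p. 277), proof] -/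
theorem testMap_comp : testMap P T' k ≫ testMap P T j' = testMap P T j'' := by
  rw [testMap, testMap, testMap, ← Over.comp_left, ← MonoidalCategory.whiskerLeft_comp, hk]

/-- **`(1 × k)^*((1 × j')^*L) ≅ (1 × j'')^*L`** (pseudofunctoriality; B-p01's `FBIso` shape). [folklore] [cite: GortzWedhorn2023, Prop. 22.90 (p. 277), proof] -/
def testModCompIso : (Scheme.Modules.pullback (testMap P T' k)).obj (testMod P T j' L) ≅ testMod P T j'' L :=
  (Scheme.Modules.pullbackComp (testMap P T' k) (testMap P T j')).app L ≪≫
    (Scheme.Modules.pullbackCongr (testMap_comp P T j' j'' k hk)).app L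

include hk in
omit [IsAffine T.left] [LinearOrder ι] [Fintype ι] [IsAffine T'.left] [IsAffine T''.left] in
/-- `V''_s ≤ (1 × k)⁻¹ V'_s` (indeed equal). [folklore] [cite: GortzWedhorn2023, Prop. 22.90 (p. 277), proof] -/
theorem cechOpen_testCover_le (s : Finset ι) :
    cechOpen (testCover P T j'' 𝓥) s ≤ testMap P T' k ⁻¹ᵁ cechOpen (testCover P T j' 𝓥) s := by
  rw [← preimage_cechOpen, ← preimage_cechOpen, ← Scheme.Hom.comp_preimage, testMap_comp P T j' j'' k hk]

/-- **The pull-back of sections along `k`**, on an open `V'' ≤ (1×k)⁻¹V'`: `x ↦ compIso(η_k(x)|)` (B-p01's `H0map`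
shape, with restriction). [folklore] [cite: GortzWedhorn2023, Prop. 22.90 (p. 277), proof] -/
def pullSecLE {V' : (P ⊗ T').left.Opens} {V'' : (P ⊗ T'').left.Opens} (h : V'' ≤ testMap P T' k ⁻¹ᵁ V') :
    SecMod (testMod P T j' L) (baseToTotal P T') V' → SecMod (testMod P T j'' L) (baseToTotal P T'') V'' := fun x =>
  SecMod.mk (((testModCompIso P T L j' j'' k hk).hom.app V'')
    (unitSectionLE (testMap P T' k) (testMod P T j' L) h (SecMod.val x)))

omit [IsAffine T.left] [IsAffine T'.left] [IsAffine T''.left] in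
/-- `pullSecLE` on underlying sections. [folklore] [cite: GortzWedhorn2023, Prop. 22.90 (p. 277), proof] -/
theorem val_pullSecLE {V' : (P ⊗ T').left.Opens} {V'' : (P ⊗ T'').left.Opens} (h : V'' ≤ testMap P T' k ⁻¹ᵁ V')
    (x : SecMod (testMod P T j' L) (baseToTotal P T') V') :
    SecMod.val (pullSecLE P T L j' j'' k hk h x) = ((testModCompIso P T L j' j'' k hk).hom.app V'')
      (unitSectionLE (testMap P T' k) (testMod P T j' L) h (SecMod.val x)) := rfl

/-- The pull-back of GLOBAL sections along `k` (B-p01's `H0map`). [folklore] [cite: GortzWedhorn2023, Prop. 22.90 (p. 277), proof] -/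
abbrev pullSec : SecMod (testMod P T j' L) (baseToTotal P T') ⊤ → SecMod (testMod P T j'' L) (baseToTotal P T'') ⊤ :=
  pullSecLE P T L j' j'' k hk (V' := ⊤) (V'' := ⊤) le_top

omit [IsAffine T.left] [IsAffine T'.left] [IsAffine T''.left] in
/-- `pullSecLE` is additive. [folklore] [cite: GortzWedhorn2023, Prop. 22.90 (p. 277), proof] -/
theorem pullSecLE_add {V' : (P ⊗ T').left.Opens} {V'' : (P ⊗ T'').left.Opens} (h : V'' ≤ testMap P T' k ⁻¹ᵁ V')
    (x y : SecMod (testMod P T j' L) (baseToTotal P T') V') :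
    pullSecLE P T L j' j'' k hk h (x + y) = pullSecLE P T L j' j'' k hk h x + pullSecLE P T L j' j'' k hk h y := by
  apply SecMod.val_injective (ρ := baseToTotal P T'')
  rw [val_pullSecLE, SecMod.val_add, SecMod.val_add, unitSectionLE_add, map_add, val_pullSecLE, val_pullSecLE]

omit [IsAffine T.left] [IsAffine T'.left] [IsAffine T''.left] in
/-- **`pullSecLE` commutes with restriction.** [folklore] [cite: GortzWedhorn2023, Prop. 22.90 (p. 277), proof] -/
theorem pullSecLE_res {V'₁ V'₂ : (P ⊗ T').left.Opens} {V''₁ V''₂ : (P ⊗ T'').left.Opens}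
    (h₁ : V''₁ ≤ testMap P T' k ⁻¹ᵁ V'₁) (h₂ : V''₂ ≤ testMap P T' k ⁻¹ᵁ V'₂) (i' : V'₂ ≤ V'₁) (i'' : V''₂ ≤ V''₁)
    (x : SecMod (testMod P T j' L) (baseToTotal P T') V'₁) :
    pullSecLE P T L j' j'' k hk h₂ (SecMod.res _ (baseToTotal P T') i' x) =
      SecMod.res _ (baseToTotal P T'') i'' (pullSecLE P T L j' j'' k hk h₁ x) := by
  apply SecMod.val_injective (ρ := baseToTotal P T'')
  rw [val_pullSecLE, SecMod.val_res, SecMod.val_res, val_pullSecLE,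
    unitSectionLE_map_of_le (testMod P T j' L) h₁ h₂ i' i'', Scheme.Modules.Hom.app_map_apply]

/-- The structure rings: `k♯` intertwines `j'♯` and `j''♯` (as an `A`-algebra map `B' → B''`). [folklore] [cite: GortzWedhorn2023, Prop. 22.90 (p. 277), proof] -/
def testAlgHom : letI := testAlgebra T j'; letI := testAlgebra T j''
    Γ(T'.left, ⊤) →ₐ[Γ(T.left, ⊤)] Γ(T''.left, ⊤) :=
  letI := testAlgebra T j'; letI := testAlgebra T j''
  { testRingHom T' k with
    commutes' := fun a => by
      change (j'.left.appLE ⊤ ⊤ le_top ≫ k.left.appLE ⊤ ⊤ le_top) a = j''.left.appLE ⊤ ⊤ le_top a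
      rw [Scheme.Hom.appLE_comp_appLE]
      subst hk
      rfl }

/-- Restrictions along any two morphisms of opens with the same ends agree. [folklore] [cite: GortzWedhorn2023, Prop. 22.90 (p. 277), proof] -/
theorem presheaf_map_congr' {Y : Scheme.{u}} (N : Y.Modules) {U V : Y.Opens} (i i' : U ⟶ V) (x : Γ(N, V)) :
    N.presheaf.map i.op x = N.presheaf.map i'.op x := by rw [Subsingleton.elim i i']

end Naturality

end Literature.AlgebraicGeometry.Modules
end
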